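import Summits.NavierStokesRegularity.NavierStokesRegularity.Theorems.TypeIliouvilleNoTypeII.Negative.NSISuperCascadePortrait
import HarnessLib

/-!
# The NSI super-cascade is a STRONG Type-II blow-up: Kelvin marginality fails for the Navier–Stokes inequality

Negative-lane support file for `stmt-NavierStokesRegularity-13638`
(`Summit.NavierStokesRegularity.NavierStokesRegularity.Theses.MarginalReynoldsCreep.NoStrongTypeII`,
"KELVIN MARGINALITY — viscosity never integrates out": for a maximal finite-energy classical
solution, `R(t) = (T−t)‖u(t)‖²_∞/ν → ∞` forces `∫ ds/R = ∞`, typed as the NON-existence of a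
positive minorant `m(t) ≤ ‖u(t,x_t)‖` on some `(t₀,T)` with `∫ dt/((T−t)² m(t)²) < ∞`).

Kill-kit K3 (model class M2′, by name): the super-similar NSI cascade `𝔲 = glueG T σ τ a z u` of an
`IsSuperBlock` datum (`NSITypeIIBlowupHolds`, `NSISuperCascadePortrait.typeII_portrait`: two-sided
rate `c (T₀−t)^{−β} ≤ sup|𝔲(t)| ≤ C (T₀−t)^{−β}` on `[0,T₀)` with `β = log_{σ⁻²} a ∈ (1/2, 3/5)`)
satisfies, at its blow-up time `T₀ = blowupTime T σ`,

* the HYPOTHESIS of the item's last arrow: `∀ M, ∀ᶠ t ↑ T₀, ∃ x, M ≤ (T₀ − t)‖𝔲(t,x)‖²`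
  (running coupling `→ ∞`; this is also the CONCLUSION of `NoBreathing`, stmt-13639, so the cascade
  is not a breather and says nothing against 13639 / 17672 / 17673), and
* the NEGATION of its conclusion: the explicit positive minorant `m(t) = c (T₀ − t)^{−β}` has
  `1/((T₀−t)² m²) = c⁻² (T₀−t)^{2β−2}` integrable on `(0, T₀)` precisely because `β > 1/2`.

So "strong Type II" in the route's sense OCCURS for compactly supported weak solutions of the
Navier–Stokes INEQUALITY with smooth slices (`exists_weakNSI_strongTypeII`): no argument using only
suitability / the local energy inequality / energy-class bounds can prove `NoStrongTypeII`; a proof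
must use an ingredient false for NSI (the momentum identity — e.g. vorticity transport / Kelvin's
circulation theorem, which is the planner's declared mechanism). Pure bookkeeping on top of the
landed M2′ dossier; the real-analysis core (`coupling_tendsto_of_rate`, `strongMinorant_of_rate`,
`not_isTypeIBlowup_of_coupling`) is stated for an arbitrary field with a power lower bound.

WHAT THIS IS NOT: not a statement about Navier–Stokes solutions (the cascade solves the NS
inequality only; it is not `IsMaximalSmoothSolution`/Leray–Hopf data of the item), hence NOT a
refutation of stmt-13638 — a placement of where its NS-specific content must lie. No new definitions.

References: W. S. Ożański, arXiv:1709.00602 (2017), §2, §5 [`Ozanski2017NSISingular`]; the route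
text of `MarginalReynoldsCreep` (crux #4) for the minorant packaging of `∫ ds/R`.
-/

noncomputable section

open MeasureTheory Set Function Filter Topology Metric intervalIntegral
open scoped ENNReal

set_option linter.dupNamespace false

namespace Summit.NavierStokesRegularity.NavierStokesRegularity.Theorems.NoStrongTypeIINegative

open Literature.Analysis.FluidPDE Literature.Barriers.NavierStokesRegularity
open Literature.Barriers.NavierStokesRegularity.Scheffer
open Summit.NavierStokesRegularity.NavierStokesRegularity.Theorems.TypeIliouvilleNoTypeIINegative

/-! ### Real-analysis core: a power lower bound with exponent `β > 1/2` -/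

section Core

variable {X E : Type*} [NormedAddCommGroup E] {v : ℝ → X → E} {T₀ c β : ℝ}

/-- Algebra of the lower bound: `(T₀−t)·(c (T₀−t)^{−β})² = c² (T₀−t)^{1−2β}` for `T₀ − t > 0`.
[folklore] -/
theorem sub_mul_sq_rate {s : ℝ} (hs : 0 < s) (c β : ℝ) :
    s * (c * s ^ (-β)) ^ 2 = c ^ 2 * s ^ (1 - 2 * β) := by
  have h1 : (s ^ (-β)) ^ 2 = s ^ (-(2 * β)) := by
    rw [sq, ← Real.rpow_add hs]; ring_nf
  have h2 : s * s ^ (-(2 * β)) = s ^ (1 - 2 * β) := by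
    conv_lhs => rw [← Real.rpow_one s]
    rw [← Real.rpow_mul hs.le, one_mul, ← Real.rpow_add hs]; ring_nf
  rw [mul_pow, h1, ← mul_assoc, mul_comm s, mul_assoc, h2]

/-- **Running coupling `→ ∞`.** If `sup|v(t)| ≥ c (T₀−t)^{−β}` on `[0,T₀)` with `c > 0`, `β > 1/2`,
`T₀ > 0`, then for every level `M` eventually (as `t ↑ T₀`) some point has `(T₀−t)|v(t,x)|² ≥ M`.
[folklore] -/
theorem coupling_tendsto_of_rate (hT₀ : 0 < T₀) (hc : 0 < c) (hβ : 1 / 2 < β)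
    (hlow : ∀ t ∈ Ico 0 T₀, ∃ x, c * (T₀ - t) ^ (-β) ≤ ‖v t x‖) :
    ∀ M : ℝ, ∀ᶠ t in 𝓝[<] T₀, ∃ x, M ≤ (T₀ - t) * ‖v t x‖ ^ 2 := by
  intro M
  have hexp : 1 - 2 * β < 0 := by linarith
  -- `T₀ − t → 0⁺` as `t ↑ T₀` (landed elsewhere as `tendsto_sub_self_nhdsLT_nhdsGT`; inlined to
  -- keep this file's imports inside the M2′ dossier)
  have hsub : Tendsto (fun t : ℝ => T₀ - t) (𝓝[<] T₀) (𝓝[>] 0) := by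
    refine tendsto_nhdsWithin_iff.2 ⟨?_, ?_⟩
    · have : Tendsto (fun t : ℝ => T₀ - t) (𝓝 T₀) (𝓝 (T₀ - T₀)) :=
        tendsto_const_nhds.sub tendsto_id
      rw [sub_self] at this
      exact this.mono_left nhdsWithin_le_nhds
    · filter_upwards [self_mem_nhdsWithin] with t ht
      exact sub_pos.2 (mem_Iio.1 ht)
  have hlim : Tendsto (fun t : ℝ => c ^ 2 * (T₀ - t) ^ (1 - 2 * β)) (𝓝[<] T₀) atTop :=
    ((tendsto_rpow_neg_nhdsGT_zero hexp).comp hsub).const_mul_atTop (pow_pos hc 2)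
  filter_upwards [hlim.eventually_ge_atTop M, Ioo_mem_nhdsLT hT₀] with t hM ht
  obtain ⟨x, hx⟩ := hlow t ⟨ht.1.le, ht.2⟩
  have hs : 0 < T₀ - t := sub_pos.2 ht.2
  refine ⟨x, hM.trans ?_⟩
  rw [← sub_mul_sq_rate hs c β]
  have h0 : 0 ≤ c * (T₀ - t) ^ (-β) := mul_nonneg hc.le (Real.rpow_nonneg hs.le _)
  exact mul_le_mul_of_nonneg_left (pow_le_pow_left₀ h0 hx 2) hs.le

/-- Algebra of the minorant integrand: `1/((T₀−t)² (c (T₀−t)^{−β})²) = (c²)⁻¹ (T₀−t)^{2β−2}`.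
[folklore] -/
theorem inv_sq_mul_sq_rate {s : ℝ} (hs : 0 < s) (c β : ℝ) :
    1 / (s ^ 2 * (c * s ^ (-β)) ^ 2) = (c ^ 2)⁻¹ * s ^ (2 * β - 2) := by
  have h1 : (s ^ (-β)) ^ 2 = s ^ (-(2 * β)) := by
    rw [sq, ← Real.rpow_add hs]; ring_nf
  have h2 : s ^ 2 * s ^ (-(2 * β)) = s ^ (2 - 2 * β) := by
    rw [show s ^ 2 = s ^ (2 : ℝ) from (Real.rpow_natCast s 2).symm, ← Real.rpow_add hs]; ring_nf
  rw [mul_pow, h1, mul_left_comm, h2, one_div, mul_inv, ← Real.rpow_neg hs.le]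
  ring_nf

/-- `t ↦ (T₀ − t)^r` is integrable on `(0, T₀)` for `r > −1`. [folklore] -/
theorem integrableOn_sub_rpow (hT₀ : 0 < T₀) {r : ℝ} (hr : -1 < r) :
    IntegrableOn (fun t : ℝ => (T₀ - t) ^ r) (Ioo 0 T₀) := by
  have h := (intervalIntegrable_rpow' (a := T₀) (b := 0) hr).comp_sub_left T₀
  rw [sub_self, sub_zero] at h
  exact (intervalIntegrable_iff_integrableOn_Ioo_of_le hT₀.le).1 h

/-- **Strong Type II in the minorant sense.** Under the same power lower bound, the explicit
positive minorant `m(t) = c (T₀−t)^{−β}` on `(0, T₀)` has `∫₀^{T₀} dt/((T₀−t)² m(t)²) < ∞` — i.e.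
`∫ ds/R < ∞`, viscosity "integrates out". [folklore] -/
theorem strongMinorant_of_rate (hT₀ : 0 < T₀) (hc : 0 < c) (hβ : 1 / 2 < β)
    (hlow : ∀ t ∈ Ico 0 T₀, ∃ x, c * (T₀ - t) ^ (-β) ≤ ‖v t x‖) :
    ∃ (m : ℝ → ℝ) (t₀ : ℝ), t₀ < T₀ ∧ (∀ t ∈ Ioo t₀ T₀, 0 < m t ∧ ∃ x, m t ≤ ‖v t x‖) ∧
      IntegrableOn (fun t => 1 / ((T₀ - t) ^ 2 * (m t) ^ 2)) (Ioo t₀ T₀) := by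
  refine ⟨fun t => c * (T₀ - t) ^ (-β), 0, hT₀, fun t ht => ?_, ?_⟩
  · exact ⟨mul_pos hc (Real.rpow_pos_of_pos (sub_pos.2 ht.2) _), hlow t ⟨ht.1.le, ht.2⟩⟩
  · have hint : IntegrableOn (fun t : ℝ => (c ^ 2)⁻¹ * (T₀ - t) ^ (2 * β - 2)) (Ioo 0 T₀) :=
      (integrableOn_sub_rpow hT₀ (by linarith)).const_mul _
    refine hint.congr_fun (fun t ht => ?_) measurableSet_Ioo
    exact (inv_sq_mul_sq_rate (sub_pos.2 ht.2) c β).symm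

end Core

section TypeI

variable {E : Type*} [NormedAddCommGroup E] {v : ℝ → E → E} {T₀ : ℝ}

/-- A field whose running coupling is unbounded along `t ↑ T₀` is not of Type I at `T₀`.
[folklore] -/
theorem not_isTypeIBlowup_of_coupling
    (h : ∀ M : ℝ, ∀ᶠ t in 𝓝[<] T₀, ∃ x, M ≤ (T₀ - t) * ‖v t x‖ ^ 2) :
    ¬ IsTypeIBlowup v T₀ := by
  rintro ⟨C, hC⟩
  obtain ⟨t, ⟨x, hx⟩, hCt, ht⟩ := ((h (C ^ 2 + 1)).and (hC.and self_mem_nhdsWithin)).exists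
  have hs : 0 < T₀ - t := sub_pos.2 ht
  have hsq : 0 < Real.sqrt (T₀ - t) := Real.sqrt_pos.2 hs
  have h1 : ‖v t x‖ * Real.sqrt (T₀ - t) ≤ C := (le_div_iff₀ hsq).1 (hCt x)
  have h0 : 0 ≤ ‖v t x‖ * Real.sqrt (T₀ - t) := mul_nonneg (norm_nonneg _) hsq.le
  have h2 : (‖v t x‖ * Real.sqrt (T₀ - t)) ^ 2 ≤ C ^ 2 := pow_le_pow_left₀ h0 h1 2
  have h3 : (‖v t x‖ * Real.sqrt (T₀ - t)) ^ 2 = (T₀ - t) * ‖v t x‖ ^ 2 := by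
    rw [mul_pow, Real.sq_sqrt hs.le, mul_comm]
  linarith

end TypeI

/-! ### The NSI super-cascade -/

section Cascade

variable {T ν₀ τ σ a : ℝ} {z : EuclideanSpace ℝ (Fin 3)} {G : Set (EuclideanSpace ℝ (Fin 3))}
  {u : ℝ → EuclideanSpace ℝ (Fin 3) → EuclideanSpace ℝ (Fin 3)}

/-- **The super-similar NSI cascade is strong Type II (running coupling `→ ∞`, integrable `ds/R`).**
For every `IsSuperBlock` datum the glued field `𝔲 = glueG T σ τ a z u` satisfies at
`T₀ = blowupTime T σ`: (i) `∀ M, ∀ᶠ t ↑ T₀, ∃ x, M ≤ (T₀−t)‖𝔲(t,x)‖²` (the hypothesis of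
`NoStrongTypeII`'s last arrow, = the conclusion of `NoBreathing`); (ii) a positive minorant `m` of
`sup|𝔲(t)|` on some `(t₀, T₀)` with `1/((T₀−t)² m²)` integrable (the negation of `NoStrongTypeII`'s
conclusion); (iii) hence not Type I. [cite: Ozanski2017NSISingular, §2, §5] -/
theorem strongTypeII_glueG (h : IsSuperBlock T ν₀ τ σ a z G u) :
    (∀ M : ℝ, ∀ᶠ t in 𝓝[<] (blowupTime T σ), ∃ x,
        M ≤ (blowupTime T σ - t) * ‖glueG T σ τ a z u t x‖ ^ 2) ∧
    (∃ (m : ℝ → ℝ) (t₀ : ℝ), t₀ < blowupTime T σ ∧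
      (∀ t ∈ Ioo t₀ (blowupTime T σ), 0 < m t ∧ ∃ x, m t ≤ ‖glueG T σ τ a z u t x‖) ∧
      IntegrableOn (fun t => 1 / ((blowupTime T σ - t) ^ 2 * (m t) ^ 2)) (Ioo t₀ (blowupTime T σ))) ∧
    ¬ IsTypeIBlowup (glueG T σ τ a z u) (blowupTime T σ) := by
  obtain ⟨hβ, ⟨c, C, hc, -, hrate⟩, -⟩ := h.typeII_portrait
  have hT₀ : 0 < blowupTime T σ := div_pos h.T_pos (by nlinarith [h.σ_sq_lt_one])
  have hlow : ∀ t ∈ Ico 0 (blowupTime T σ), ∃ x,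
      c * (blowupTime T σ - t) ^ (-Real.logb ((σ⁻¹) ^ 2) a) ≤ ‖glueG T σ τ a z u t x‖ :=
    fun t ht => (hrate t ht).1
  have hcoup := coupling_tendsto_of_rate hT₀ hc hβ.1 hlow
  exact ⟨hcoup, strongMinorant_of_rate hT₀ hc hβ.1 hlow, not_isTypeIBlowup_of_coupling hcoup⟩

/-- **Headline (K3 certificate for stmt-13638).** There are `ν₀ > 0` and a compactly supported field
`v` with `C^∞` slices, a weak solution of the Navier–Stokes INEQUALITY for every `ν ∈ [0, ν₀]`,
blowing up at some `T₀ > 0` with running coupling `(T₀−t)·sup|v(t)|² → ∞` (no breathing), NOT of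
Type I, and STRONG Type II: a positive minorant `m ≤ sup|v(t)|` on some `(t₀,T₀)` with
`∫ dt/((T₀−t)² m²) < ∞`. WHAT THIS IS NOT: `v` is not a Navier–Stokes solution.
[cite: Ozanski2017NSISingular, §2, §5] -/
theorem exists_weakNSI_strongTypeII :
    ∃ ν₀ : ℝ, 0 < ν₀ ∧
      ∃ (K : Set (EuclideanSpace ℝ (Fin 3)))
        (v : ℝ → EuclideanSpace ℝ (Fin 3) → EuclideanSpace ℝ (Fin 3))
        (p : ℝ → EuclideanSpace ℝ (Fin 3) → ℝ),
        IsCompact K ∧ (∀ ν ∈ Icc (0 : ℝ) ν₀, IsWeakNSISolution ν v p) ∧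
        (∀ t : ℝ, 0 ≤ t → ContDiff ℝ ((⊤ : ℕ∞) : WithTop ℕ∞) (v t) ∧ tsupport (v t) ⊆ K) ∧
        ∃ T₀ : ℝ, 0 < T₀ ∧
          (∀ M : ℝ, ∀ᶠ t in 𝓝[<] T₀, ∃ x, M ≤ (T₀ - t) * ‖v t x‖ ^ 2) ∧
          ¬ IsTypeIBlowup v T₀ ∧
          ∃ (m : ℝ → ℝ) (t₀ : ℝ), t₀ < T₀ ∧ (∀ t ∈ Ioo t₀ T₀, 0 < m t ∧ ∃ x, m t ≤ ‖v t x‖) ∧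
            IntegrableOn (fun t => 1 / ((T₀ - t) ^ 2 * (m t) ^ 2)) (Ioo t₀ T₀) := by
  obtain ⟨β₀, hβ₀, -, hreach⟩ := exists_isSuperBlock_rateExp_eq
  obtain ⟨T, ν₀, τ, σ, a, z, G, u, hS, -⟩ := hreach β₀ ⟨hβ₀, le_rfl⟩
  obtain ⟨hcoup, hstrong, hnI⟩ := strongTypeII_glueG hS
  have hT₀ : 0 < blowupTime T σ := div_pos hS.T_pos (by nlinarith [hS.σ_sq_lt_one])
  exact ⟨ν₀, hS.block.ν₀_pos, G, glueG T σ τ a z u, fun t => normalisedPressure (glueG T σ τ a z u t),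
    hS.block.isCompact, fun ν hν => hS.isWeakNSISolution_glueG hν,
    fun t _ => ⟨hS.contDiff_glueG_slice t, hS.tsupport_glueG_slice_subset t⟩,
    blowupTime T σ, hT₀, hcoup, hnI, hstrong⟩

end Cascade

end Summit.NavierStokesRegularity.NavierStokesRegularity.Theorems.NoStrongTypeIINegative

end
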